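import Literature.NumberTheory.Automorphic.HilbertRepKTypeMultiplicity
import Literature.RepresentationTheory.CompactGroups.OuterTensorProductIsotypicRestriction
import HarnessLib

/-!
# The multiplicity space of `σ` in `π ⊗ σ` is `π`: `Θ_{π ⊗ σ}(σ) ≅ π` — ANY groups

Topic `Literature/NumberTheory/Automorphic` (`HilbertRepSpectrum` vocabulary); theorems only, no definition, no named fact.

Bröcker–tom Dieck II (4.14), proof (PDF p. 80): «`Hom_H(W_j, U)` … Now decompose `Hom_H(W_j, U) = ⊕_i n_ij V_i` as a
`G`-module» — for `U = V ⊗ W` itself, `Hom_H(W, V ⊗ W) ≅ V ⊗ End_H(W) ≅ V`.  Here, for ANY groups `G`, `K`, a unitary `π` on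
a finite-dimensional `E` and an irreducible unitary `σ` on `F`: the slice map `v ↦ (f ↦ v ⊗ f)` is a `G`-equivariant linear
isomorphism `E ≃ Θ(σ) = HomSpace σ ((π ⊗ σ)|_K)` onto the Hilbert–Schmidt multiplicity space of `HilbertRepMultiplicitySpace`,
by injectivity of slices and the any-group count `dim Θ(σ) · dim σ = dim X_σ = dim (E ⊗ F)`
(`finrank_isotypicComponent_eq_finrank_mul_finrank_intertwiners'`, `isotypicComponent_outerTensor_restrict_inr_eq_top'`).

* `exists_sliceMap_homSpace_outerTensor` — the slice `v ↦ (f ↦ v ⊗ f)` as a linear map `E →ₗ Θ(σ)` (through `HomSpace.mk`; no new definition);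
* `finrank_homSpace_outerTensor_restrict_inr` — **`dim Θ_{π⊗σ}(σ) = dim π`**;
* `exists_linearEquiv_homSpace_outerTensor_restrict_inr` — **`E ≃ₗ Θ_{π⊗σ}(σ)`, `v ↦ (f ↦ v ⊗ f)`, intertwining `π` and
  `(π ⊗ σ).homRep σ`**;
* `nonempty_equiv_homRep_outerTensor` — **`π ≃ Θ_{π⊗σ}(σ)` as `ContRepresentation`s** (`ContRepresentation.Equiv`);
* `isotypicComponent_outerTensor_restrict_inr_eq_bot`, `multiplicity_outerTensor_restrict_inr_eq_zero`,
  `intertwiners_outerTensor_restrict_inr_eq_bot`, `isotypicComponent_outerTensor_restrict_inl_eq_bot` — **the other classes: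
  `X_{σ'}((π⊗σ)|_K) = 0`, `mult = 0`, `Θ_{π⊗σ}(σ') = 0` for `σ' ≄ σ`** (any groups; `n_ij = 0` off the diagonal).

## References
* T. Bröcker, T. tom Dieck, *Representations of Compact Lie Groups*, GTM 98 (1985), II Prop (4.14) proof, PDF p. 80
  [BrockerTomDieck1985].
* A. Deitmar, S. Echterhoff, *Principles of Harmonic Analysis*, 2nd ed. (2014), §7.3 Lemma 7.3.1, Thm. 7.3.2, PDF pp. 197–198
  [DeitmarEchterhoff2014].

## Provenance
Lane `lit-hodgefound` (HOME `run/shared/lean/pub/lit-hodgefound/`), prover seat `lit-hodgefound-p05` generation 7 (Layer 0,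
beneath C2-08 / C2-10).
-/

noncomputable section

open ContinuousLinearMap
open Literature.RepresentationTheory.CompactGroups Literature.NumberTheory.Automorphic
open scoped InnerProductSpace TensorProduct

namespace ContRepresentation

section Slice

variable {G K : Type*} [Group G] [Group K]
variable {E F : Type*} [NormedAddCommGroup E] [InnerProductSpace ℂ E] [FiniteDimensional ℂ E]
  [NormedAddCommGroup F] [InnerProductSpace ℂ F] [FiniteDimensional ℂ F]
variable {π : ContRepresentation ℂ G E} {σ : ContRepresentation ℂ K F}

omit [FiniteDimensional ℂ E] in
/-- The slice `v ↦ (f ↦ v ⊗ f)` as a linear map `E →ₗ Θ(σ) = HomSpace σ ((π ⊗ σ)|_K)` (any groups): additivity and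
homogeneity of `v ↦ v ⊗ f`. [cite: BrockerTomDieck1985, II Prop (4.14)] -/
theorem exists_sliceMap_homSpace_outerTensor :
    ∃ S : E →ₗ[ℂ] HomSpace σ ((π.outerTensor σ).restrict (MonoidHom.inr G K)),
      ∀ (v : E) (f : F), (S v).toCLM f = v ⊗ₜ[ℂ] f := by
  refine ⟨{ toFun := fun v => HomSpace.mk (LinearMap.toContinuousLinearMap (TensorProduct.mk ℂ E F v))
              (mk_mem_intertwiners_outerTensor_restrict_inr (π := π) (σ := σ) v)
            map_add' := fun v w => ?_
            map_smul' := fun c v => ?_ }, fun v f => rfl⟩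
  · refine HomSpace.ext (ContinuousLinearMap.ext fun f => ?_)
    rw [HomSpace.toCLM_add]
    change (v + w) ⊗ₜ[ℂ] f = v ⊗ₜ[ℂ] f + w ⊗ₜ[ℂ] f
    exact TensorProduct.add_tmul v w f
  · refine HomSpace.ext (ContinuousLinearMap.ext fun f => ?_)
    rw [HomSpace.toCLM_smul, RingHom.id_apply]
    change (c • v) ⊗ₜ[ℂ] f = c • v ⊗ₜ[ℂ] f
    exact TensorProduct.smul_tmul' c v f |>.symm

/-- **`dim Θ_{π⊗σ}(σ) = dim π`** for ANY groups (`π` unitary, `σ` irreducible unitary): `dim Θ(σ) · dim σ = dim X_σ((π⊗σ)|_K)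
= dim (E ⊗ F)`. [cite: BrockerTomDieck1985, II Prop (4.14)] [cite: DeitmarEchterhoff2014, Thm. 7.3.2] -/
theorem finrank_homSpace_outerTensor_restrict_inr [σ.toRepresentation.IsIrreducible]
    (hπu : ∀ (g : G) (v w : E), ⟪π g v, π g w⟫_ℂ = ⟪v, w⟫_ℂ) (hσu : ∀ (k : K) (v w : F), ⟪σ k v, σ k w⟫_ℂ = ⟪v, w⟫_ℂ) :
    Module.finrank ℂ (HomSpace σ ((π.outerTensor σ).restrict (MonoidHom.inr G K))) = Module.finrank ℂ E := by
  haveI : CompleteSpace (E ⊗[ℂ] F) := FiniteDimensional.complete ℂ (E ⊗[ℂ] F)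
  haveI : Nontrivial F := IsSimpleModule.nontrivial (MonoidAlgebra ℂ K) σ.toRepresentation.asModule
  set ρ := (π.outerTensor σ).restrict (MonoidHom.inr G K) with hρ
  have hρu : ρ.IsUnitary := isUnitary_outerTensor_restrict_inr (π := π) (σ := σ) hπu hσu
  have htop : (ρ.isotypicComponent σ).toSubmodule = ⊤ := isotypicComponent_outerTensor_restrict_inr_eq_top' hπu hσu
  have h := finrank_isotypicComponent_eq_finrank_mul_finrank_intertwiners' hρu hσu
  have hdim : Module.finrank ℂ (ρ.isotypicComponent σ).toSubmodule = Module.finrank ℂ E * Module.finrank ℂ F := by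
    rw [htop, finrank_top, Module.finrank_tensorProduct]
  rw [hdim, mul_comm (Module.finrank ℂ E)] at h
  exact (Nat.eq_of_mul_eq_mul_left Module.finrank_pos h).symm

/-- **`E ≃ₗ Θ_{π⊗σ}(σ)` by `v ↦ (f ↦ v ⊗ f)`, intertwining `π` and the `G`-action on `Θ(σ)`** (`(g·S) = (π⊗σ)(g, 1) ∘ S`,
`ContRepresentation.homRep`) — ANY groups, `π` unitary, `σ` irreducible unitary: the slice map is injective
(`⟪v ⊗ f, v ⊗ f⟫ = ‖v‖² ‖f‖²`) between spaces of the same dimension. [cite: BrockerTomDieck1985, II Prop (4.14)] -/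
theorem exists_linearEquiv_homSpace_outerTensor_restrict_inr [σ.toRepresentation.IsIrreducible]
    (hπu : ∀ (g : G) (v w : E), ⟪π g v, π g w⟫_ℂ = ⟪v, w⟫_ℂ) (hσu : ∀ (k : K) (v w : F), ⟪σ k v, σ k w⟫_ℂ = ⟪v, w⟫_ℂ) :
    ∃ e : E ≃ₗ[ℂ] HomSpace σ ((π.outerTensor σ).restrict (MonoidHom.inr G K)),
      (∀ (v : E) (f : F), (e v).toCLM f = v ⊗ₜ[ℂ] f) ∧
        ∀ (g : G) (v : E), e (π g v) = (π.outerTensor σ).homRep σ g (e v) := by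
  haveI : CompleteSpace (E ⊗[ℂ] F) := FiniteDimensional.complete ℂ (E ⊗[ℂ] F)
  haveI : Nontrivial F := IsSimpleModule.nontrivial (MonoidAlgebra ℂ K) σ.toRepresentation.asModule
  set ρ := (π.outerTensor σ).restrict (MonoidHom.inr G K) with hρ
  have hρu : ρ.IsUnitary := isUnitary_outerTensor_restrict_inr (π := π) (σ := σ) hπu hσu
  obtain ⟨S, hS⟩ := exists_sliceMap_homSpace_outerTensor (π := π) (σ := σ)
  -- injective: `v ⊗ f₀ = 0` with `f₀ ≠ 0` forces `v = 0`
  obtain ⟨f₀, hf₀⟩ := exists_ne (0 : F)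
  have hinj : Function.Injective S := by
    refine (injective_iff_map_eq_zero S).mpr fun v hv => ?_
    have h0 : v ⊗ₜ[ℂ] f₀ = 0 := by rw [← hS v f₀, hv, HomSpace.toCLM_zero, _root_.zero_apply]
    have hinner : ⟪v, v⟫_ℂ * ⟪f₀, f₀⟫_ℂ = 0 := by rw [← TensorProduct.inner_tmul, h0, inner_zero_left]
    rcases mul_eq_zero.mp hinner with h | h
    · exact inner_self_eq_zero.mp h
    · exact absurd (inner_self_eq_zero.mp h) hf₀
  -- same dimension, hence bijective
  have hfinΘ : FiniteDimensional ℂ (Schur.intertwiners σ ρ) := (finiteDimensional_intertwiners_iff hρu hσu).mpr inferInstance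
  haveI : FiniteDimensional ℂ (HomSpace σ ρ) := hfinΘ
  have hdim : Module.finrank ℂ E = Module.finrank ℂ (HomSpace σ ρ) :=
    (finrank_homSpace_outerTensor_restrict_inr hπu hσu).symm
  have hsurj : Function.Surjective S := (LinearMap.injective_iff_surjective_of_finrank_eq_finrank hdim).mp hinj
  refine ⟨LinearEquiv.ofBijective S ⟨hinj, hsurj⟩, fun v f => hS v f, fun g v => ?_⟩
  refine HomSpace.ext (ContinuousLinearMap.ext fun f => ?_)
  rw [LinearEquiv.ofBijective_apply, LinearEquiv.ofBijective_apply, hS, toCLM_homRep_apply,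
    ContinuousLinearMap.comp_apply, hS]
  change π g v ⊗ₜ[ℂ] f = (π.outerTensor σ) (g, (1 : K)) (v ⊗ₜ[ℂ] f)
  rw [ContRepresentation.outerTensor_apply_tmul, map_one]
  rfl

/-- **`π ≃ Θ_{π⊗σ}(σ)` as representations of `G`** (`ContRepresentation.Equiv`, with the Hilbert–Schmidt model
`ContRepresentation.homRep`) — Bröcker–tom Dieck's «`Hom_H(W, V ⊗ W) ≅ V`», any groups. [cite: BrockerTomDieck1985, II Prop (4.14)] -/
theorem nonempty_equiv_homRep_outerTensor [σ.toRepresentation.IsIrreducible]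
    (hπu : ∀ (g : G) (v w : E), ⟪π g v, π g w⟫_ℂ = ⟪v, w⟫_ℂ) (hσu : ∀ (k : K) (v w : F), ⟪σ k v, σ k w⟫_ℂ = ⟪v, w⟫_ℂ) :
    Nonempty (ContRepresentation.Equiv π ((π.outerTensor σ).homRep σ)) := by
  haveI : CompleteSpace (E ⊗[ℂ] F) := FiniteDimensional.complete ℂ (E ⊗[ℂ] F)
  obtain ⟨e, -, he⟩ := exists_linearEquiv_homSpace_outerTensor_restrict_inr (π := π) (σ := σ) hπu hσu
  haveI : FiniteDimensional ℂ (HomSpace σ ((π.outerTensor σ).restrict (MonoidHom.inr G K))) :=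
    LinearEquiv.finiteDimensional e
  refine ⟨ContRepresentation.Equiv.mk e.toContinuousLinearEquiv fun g => ?_⟩
  refine ContinuousLinearMap.ext fun v => ?_
  rw [ContinuousLinearMap.comp_apply, ContinuousLinearMap.comp_apply]
  exact he g v

end Slice

/-! ### The other classes: `Θ_{π⊗σ}(σ') = 0` for `σ' ≄ σ` — any groups -/

section OtherClasses

variable {G K : Type*} [Group G] [Group K]
variable {E F : Type*} [NormedAddCommGroup E] [InnerProductSpace ℂ E] [FiniteDimensional ℂ E]
  [NormedAddCommGroup F] [InnerProductSpace ℂ F] [FiniteDimensional ℂ F]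
variable {π : ContRepresentation ℂ G E} {σ : ContRepresentation ℂ K F}

/-- **`X_{σ'}((π ⊗ σ)|_K) = 0` for `σ'` not unitarily equivalent to the irreducible `σ`** — ANY groups: the restriction is
purely `σ`-isotypic (`isotypicComponent_outerTensor_restrict_inr_eq_top'`) and isotypic components of inequivalent classes
are orthogonal (`isOrtho_isotypicComponent`). [cite: BrockerTomDieck1985, II Prop (4.14)] [cite: DeitmarEchterhoff2014, Thm. 7.3.2] -/
theorem isotypicComponent_outerTensor_restrict_inr_eq_bot {F' : Type*} [NormedAddCommGroup F'] [InnerProductSpace ℂ F']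
    {σ' : ContRepresentation ℂ K F'} [σ.toRepresentation.IsIrreducible]
    (hπu : ∀ (g : G) (v w : E), ⟪π g v, π g w⟫_ℂ = ⟪v, w⟫_ℂ) (hσu : ∀ (k : K) (v w : F), ⟪σ k v, σ k w⟫_ℂ = ⟪v, w⟫_ℂ)
    (hne : ¬ AreUnitarilyEquivalent σ σ') :
    ((π.outerTensor σ).restrict (MonoidHom.inr G K)).isotypicComponent σ' = ⊥ := by
  haveI : CompleteSpace (E ⊗[ℂ] F) := FiniteDimensional.complete ℂ (E ⊗[ℂ] F)
  set ρ := (π.outerTensor σ).restrict (MonoidHom.inr G K) with hρ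
  have hρu : ρ.IsUnitary := isUnitary_outerTensor_restrict_inr (π := π) (σ := σ) hπu hσu
  have h := isOrtho_isotypicComponent (π := ρ) (σ := σ) hρu hne
  rw [isotypicComponent_outerTensor_restrict_inr_eq_top' hπu hσu, Submodule.isOrtho_top_left] at h
  refine ClosedSubrep.ext fun v => ?_
  rw [← ClosedSubrep.mem_toSubmodule, h, ← ClosedSubrep.mem_toSubmodule, ClosedSubrep.toSubmodule_bot]

/-- **`mult(σ', (π ⊗ σ)|_K) = 0` for `σ' ≄ σ`** (any groups; `σ` irreducible unitary, `π` unitary, `V_{σ'} ≠ 0`).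
[cite: BrockerTomDieck1985, II Prop (4.14)] [cite: DeitmarEchterhoff2014, Thm. 7.3.2] -/
theorem multiplicity_outerTensor_restrict_inr_eq_zero {F' : Type*} [NormedAddCommGroup F'] [InnerProductSpace ℂ F']
    [FiniteDimensional ℂ F'] {σ' : ContRepresentation ℂ K F'} [σ.toRepresentation.IsIrreducible] [Nontrivial F']
    (hπu : ∀ (g : G) (v w : E), ⟪π g v, π g w⟫_ℂ = ⟪v, w⟫_ℂ) (hσu : ∀ (k : K) (v w : F), ⟪σ k v, σ k w⟫_ℂ = ⟪v, w⟫_ℂ)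
    (hne : ¬ AreUnitarilyEquivalent σ σ') :
    ((π.outerTensor σ).restrict (MonoidHom.inr G K)).multiplicity σ' = 0 := by
  haveI : CompleteSpace (E ⊗[ℂ] F) := FiniteDimensional.complete ℂ (E ⊗[ℂ] F)
  have hρu := isUnitary_outerTensor_restrict_inr (π := π) (σ := σ) hπu hσu
  exact (hρu.multiplicity_eq_zero_iff (τ := σ')).mpr (isotypicComponent_outerTensor_restrict_inr_eq_bot hπu hσu hne)

/-- **`Θ_{π⊗σ}(σ') = Hom_K(σ', (π ⊗ σ)|_K) = 0` for an irreducible unitary `σ' ≄ σ`** — ANY groups (so `HomSpace σ' ((π⊗σ)|_K)`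
is trivial): Bröcker–tom Dieck II (4.14)'s `n_ij = 0` off the diagonal for `U = V ⊗ W`. [cite: BrockerTomDieck1985, II Prop (4.14)] -/
theorem intertwiners_outerTensor_restrict_inr_eq_bot {F' : Type*} [NormedAddCommGroup F'] [InnerProductSpace ℂ F']
    [FiniteDimensional ℂ F'] {σ' : ContRepresentation ℂ K F'} [σ.toRepresentation.IsIrreducible]
    [σ'.toRepresentation.IsIrreducible]
    (hπu : ∀ (g : G) (v w : E), ⟪π g v, π g w⟫_ℂ = ⟪v, w⟫_ℂ) (hσu : ∀ (k : K) (v w : F), ⟪σ k v, σ k w⟫_ℂ = ⟪v, w⟫_ℂ)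
    (hσ'u : ∀ (k : K) (v w : F'), ⟪σ' k v, σ' k w⟫_ℂ = ⟪v, w⟫_ℂ) (hne : ¬ AreUnitarilyEquivalent σ σ') :
    Schur.intertwiners σ' ((π.outerTensor σ).restrict (MonoidHom.inr G K)) = ⊥ := by
  haveI : CompleteSpace (E ⊗[ℂ] F) := FiniteDimensional.complete ℂ (E ⊗[ℂ] F)
  have hρu := isUnitary_outerTensor_restrict_inr (π := π) (σ := σ) hπu hσu
  exact (intertwiners_eq_bot_iff_isotypicComponent_eq_bot hρu hσ'u).mpr
    (isotypicComponent_outerTensor_restrict_inr_eq_bot hπu hσu hne)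

/-- Symmetrically, **`X_{π'}((π ⊗ σ)|_G) = 0` for `π' ≄ π`** (`π` irreducible unitary, `σ` unitary; any groups).
[cite: BrockerTomDieck1985, II Prop (4.14)] [cite: DeitmarEchterhoff2014, Thm. 7.3.2] -/
theorem isotypicComponent_outerTensor_restrict_inl_eq_bot {E' : Type*} [NormedAddCommGroup E'] [InnerProductSpace ℂ E']
    {π' : ContRepresentation ℂ G E'} [π.toRepresentation.IsIrreducible]
    (hπu : ∀ (g : G) (v w : E), ⟪π g v, π g w⟫_ℂ = ⟪v, w⟫_ℂ) (hσu : ∀ (k : K) (v w : F), ⟪σ k v, σ k w⟫_ℂ = ⟪v, w⟫_ℂ)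
    (hne : ¬ AreUnitarilyEquivalent π π') :
    ((π.outerTensor σ).restrict (MonoidHom.inl G K)).isotypicComponent π' = ⊥ := by
  haveI : CompleteSpace (E ⊗[ℂ] F) := FiniteDimensional.complete ℂ (E ⊗[ℂ] F)
  set ρ := (π.outerTensor σ).restrict (MonoidHom.inl G K) with hρ
  have hρu : ρ.IsUnitary := isUnitary_outerTensor_restrict_inl (π := π) (σ := σ) hπu hσu
  have h := isOrtho_isotypicComponent (π := ρ) (σ := π) hρu hne
  rw [isotypicComponent_outerTensor_restrict_inl_eq_top' hπu hσu, Submodule.isOrtho_top_left] at h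
  refine ClosedSubrep.ext fun v => ?_
  rw [← ClosedSubrep.mem_toSubmodule, h, ← ClosedSubrep.mem_toSubmodule, ClosedSubrep.toSubmodule_bot]

end OtherClasses

end ContRepresentation

end
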